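import Literature.Analysis.FluidPDE.ConstantinFeffermanHolds
import Summits.NavierStokesRegularity.NavierStokesRegularity.Theorems.CertifiedBlowupCertifiedBlowupAxisymBlowupSwirlPersists
import HarnessLib

/-!
# Witnesses of the crux `CertifiedBlowupAxisymBlowup`: the vorticity direction is not
# Lipschitz-coherent in any high-vorticity region (Constantin–Fefferman 1993 at the crux)

Theorems file landed `--supports stmt-NavierStokesRegularity-0727`, line `compact-amplification`
(continuation lead c3, wave 1). The crux asks for a viscosity `ν > 0`, a time `T > 0` and a maximal
smooth solution `(u, p)` of lifespan `T`, Leray–Hopf on `[0, T]` from its rapidly decaying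
axisymmetric datum `u 0`. This file proves, for an ARBITRARY such witness, the contrapositive of the
Constantin–Fefferman direction-of-vorticity criterion (Indiana Univ. Math. J. 42 (1993), Theorem of
§1), which is a THEOREM of the tree (`constantin_fefferman_holds`): for every vorticity level `Ω > 0`
and every length `ρ > 0` there are a time `t ∈ [0, T)` and points `x`, `y` of the region
`{|ω(t, ·)| > Ω}` at which the sine of the angle between the vorticity directions
`ξ = ω/|ω|` exceeds `|x − y|/ρ`:
`|x − y|/ρ < √(1 − ⟪ξ(t, x), ξ(t, y)⟫²)`
(`vorticityDirection_incoherent_of_isMaximalSmoothSolution`, registered stub). In words: along a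
witness the vorticity direction is Lipschitz-coherent at NO scale in the high-vorticity region — a
geometric constraint on Hou-type axisymmetric scenarios (`ω_θ`-sheets against the swirl-generated
`(ω_r, ω_z)`).

The BKM-class hypothesis of the tree fact (all `L²` Sobolev seminorms bounded on every `[0, T'']`,
`T'' < T`) is discharged for witnesses by the Tao-class developments of the datum below the lifespan
(`exists_isTaoSolutionOn_of_lerayHopf_classical`), and continuation in the BKM class
(`HasSobolevExtensionPast`) contradicts maximality through
`HasSobolevExtensionPast.hasSmoothExtensionPast`.

No new definitions, no named-fact hypotheses, no `sorry`.

## References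

* P. Constantin, C. Fefferman, *Direction of vorticity and the problem of global regularity for
  the Navier–Stokes equations*, Indiana Univ. Math. J. 42 (1993), 775–789, Theorem (§1).
  [ConstantinFeffermanIndiana1993]
* P. G. Lemarié-Rieusset, *The Navier–Stokes Problem in the 21st Century*, CRC Press (2016),
  §11.6, Thm. 11.7; Thm. 7.2 and Prop. 12.3. [LemarieRieusset2016]
* J. T. Beale, T. Kato, A. Majda, Comm. Math. Phys. 94 (1984), Theorem 1 and Corollary.
  [BealeKatoMajda1984]
-/

-- the summit and its single problem share the name (D-0017 nested layout)
set_option linter.dupNamespace false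

noncomputable section

open MeasureTheory Set Function Filter Topology Metric
open scoped ENNReal NNReal

namespace Summit.NavierStokesRegularity.NavierStokesRegularity.Theorems.CertifiedBlowupAxisymBlowup.CompactAmplification

open Literature.Analysis.FluidPDE

section Witness

variable {ν T : ℝ} {u : ℝ → (EuclideanSpace ℝ (Fin 3)) → (EuclideanSpace ℝ (Fin 3))} {p : ℝ → (EuclideanSpace ℝ (Fin 3)) → ℝ}

/-- **A classical Leray–Hopf solution from a rapidly decaying datum lies in the Beale–Kato–Majda
class on every compact sub-slab `[0, T''] × ℝ³`, `T'' < T`**: all `L²` Sobolev seminorms of `u t`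
are bounded uniformly in `t ∈ [0, T'']`. For `T'' < 0` the slab is empty; for `0 ≤ T'' < T` the
Tao-class development `(U, P)` of `u 0` on `[0, t]`, `t = (T'' + T)/2`
(`exists_isTaoSolutionOn_of_lerayHopf_classical`), has bounded Sobolev norms
(`IsTaoSolutionOn.sobolev`) and agrees with `u` there. (Private copy of the hypothesis `hreg` of the
tree's continuation criteria, for this file only.) [cite: LemarieRieusset2016, Thm. 7.2 and Prop. 12.3] -/
private theorem cf_hasBoundedSobolevNormsOn_before (hν : 0 < ν) (hT : 0 < T)
    (hcl : IsClassicalNSSolutionOn (Ico 0 T) ν 0 u p) (hLH : IsLerayHopfOn T ν 0 (u 0) u)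
    (hdec : HasRapidSpatialDecay (u 0)) : ∀ T'' < T, HasBoundedSobolevNormsOn (Icc 0 T'') u := by
  intro T'' hT''
  rcases lt_or_ge T'' 0 with h | h
  · -- empty slab
    intro n
    exact ⟨0, fun t ht => absurd (ht.1.trans ht.2) (not_le.2 h)⟩
  · -- the Tao-class development on `[0, t]`, `T'' < t < T`
    set t : ℝ := (T'' + T) / 2 with ht_def
    have ht0 : 0 < t := by rw [ht_def]; linarith
    have htT : t < T := by rw [ht_def]; linarith
    have hT''t : T'' ≤ t := by rw [ht_def]; linarith
    obtain ⟨U, P, hU, hUeq⟩ :=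
      exists_isTaoSolutionOn_of_lerayHopf_classical hν hT hcl hLH hdec ht0 htT
    intro n
    obtain ⟨C, hC⟩ := hU.sobolev n
    refine ⟨C, fun s hs => ?_⟩
    have hsI : s ∈ Icc 0 t := ⟨hs.1, hs.2.trans hT''t⟩
    rw [← hUeq s hsI]
    exact hC s hsI

end Witness

/-- **The vorticity direction of a witness is not Lipschitz-coherent in any high-vorticity region**
(registered stub of stmt-NavierStokesRegularity-0727; Constantin–Fefferman 1993, Theorem of §1, at
the crux, i.e. the contrapositive of the tree theorem `constantin_fefferman_holds`). For every
maximal Leray–Hopf classical solution `(u, p)` of viscosity `ν > 0` and finite lifespan `T > 0`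
from a rapidly decaying axisymmetric datum, and for all `Ω > 0`, `ρ > 0`, there are `t ∈ [0, T)`
and points `x`, `y` with `|ω(t, x)|, |ω(t, y)| > Ω` (`ω = curl u`) such that
`|x − y|/ρ < √(1 − ⟪ξ(t, x), ξ(t, y)⟫²)`, `ξ = vorticityDirection ω` — otherwise the direction
hypothesis of Constantin–Fefferman holds on `[0, T)`, the solution continues in the BKM class past
`T` (`constantin_fefferman_holds`, with the BKM-class hypothesis supplied by
`cf_hasBoundedSobolevNormsOn_before`), hence classically
(`HasSobolevExtensionPast.hasSmoothExtensionPast`), contradicting maximality. (Axisymmetry of the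
datum is part of the crux's data but is not used.) [cite: ConstantinFeffermanIndiana1993, Theorem (§1)] -/
theorem vorticityDirection_incoherent_of_isMaximalSmoothSolution : ∀ {ν T : ℝ} {u : ℝ → EuclideanSpace ℝ (Fin 3) → EuclideanSpace ℝ (Fin 3)} {p : ℝ → EuclideanSpace ℝ (Fin 3) → ℝ}, 0 < ν → 0 < T → IsMaximalSmoothSolution ν 0 u p T → IsLerayHopfOn T ν 0 (u 0) u → HasRapidSpatialDecay (u 0) → IsAxisymmetric (u 0) → ∀ Ω ρ : ℝ, 0 < Ω → 0 < ρ → ∃ t ∈ Set.Ico 0 T, ∃ x y : EuclideanSpace ℝ (Fin 3), Ω < ‖curl (u t) x‖ ∧ Ω < ‖curl (u t) y‖ ∧ ‖x - y‖ / ρ < Real.sqrt (1 - inner ℝ (vorticityDirection (curl (u t)) x) (vorticityDirection (curl (u t)) y) ^ 2) := by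
  intro ν T u p hν hT hmax hLH hdec _ Ω ρ hΩ hρ
  by_contra h
  push Not at h
  exact hmax.2 (constantin_fefferman_holds hν hT hΩ hρ hmax.1
    (cf_hasBoundedSobolevNormsOn_before hν hT hmax.1 hLH hdec) h).hasSmoothExtensionPast

end Summit.NavierStokesRegularity.NavierStokesRegularity.Theorems.CertifiedBlowupAxisymBlowup.CompactAmplification

end
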